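import Literature.Topology.PlaneTopology.CrosscutProofs
import Literature.Topology.PlaneTopology.UniformLocalConnectedness
import HarnessLib

/-!
# Gates: the arcs in which a Jordan domain meets a Jordan loop, as cross-cuts

Topic: Topology / PlaneTopology (sequel to `Crosscut.lean`, `CrosscutProofs.lean`). Let `D` be a
Jordan domain and `Q` another Jordan domain (in the applications an axis-parallel box about a
boundary point of `D`, `Rectangles.rect`), whose boundary loop `∂Q = range Q.boundary` has two
distinct points off `D`. The open set `D ∩ ∂Q` is a disjoint union of open sub-arcs of the loop,
the **gates** of `D` on `∂Q`; in loop parameters the gate through `Q.boundary t₀ ∈ D` is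
`Q.boundary '' (gateLo, gateHi)` with `gateLo < t₀ < gateHi < gateLo + 1`, the maximal parameter
interval about `t₀` mapped into `D` (`gateLo`/`gateHi` are the nearest parameters mapped off `D`).
Its closure `gateArc = Q.boundary '' [gateLo, gateHi]` is a cross-cut of `D` (a simple arc with
end-points on `∂D` and interior in `D`, `JordanDomain.IsCrosscut`), so Newman's cross-cut theorem
(`Newman1939_crosscut_holds`) splits `D` minus the gate into exactly two domains, each having the
gate in its frontier (`exists_gate_sides`). This is the geometric input of the "germ regions"
`U(s)` about a boundary point used for boundary Harnack-type estimates of lattice harmonic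
functions (Chelkak–Wan 2021, §3.2: the arcs `S_o(b,r)` of `∂B(b,r) ∩ Ω`).

* `JordanDomain.exists_int_abs_sub_lt_of_dist_lt` — points of a Jordan loop that are close have
  close parameters modulo `1` (inverse continuity of the loop);
* `gateLo`, `gateHi`, `gateLo_lt`, `lt_gateHi`, `gateHi_sub_gateLo_lt_one`, `boundary_mem_of_mem_Ioo_gate`,
  `boundary_gateLo_not_mem`, `boundary_gateHi_not_mem`, `gateLo_eq_of_mem`/`gateHi_eq_of_mem`
  (canonicity), `gate`, `gateArc`, `isSimpleArc_gateArc`, `isCrosscut_gateArc`,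
  `boundary_gateLo_mem_frontier`;
* `exists_gate_sides` — Newman's theorem for a gate.

Everything is proved. [folklore; Newman 1939 Ch. V §11]
-/

noncomputable section

namespace Literature.Topology.PlaneTopology

open Set Metric Filter _root_.Topology
open Literature.Probability.RandomPlanarGeometry (JordanDomain)
open Literature.Probability.RandomPlanarGeometry.JordanDomain

/-! ### Inverse continuity of a Jordan loop -/

/-- **Close points of a Jordan loop have close parameters (mod 1).** For `τ ∈ (0, 1/2]` there is
`m > 0` such that `dist (boundary θ) (boundary φ) < m` forces `|φ - θ - k| < τ` for some integer
`k`. [folklore] -/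
theorem _root_.Literature.Probability.RandomPlanarGeometry.JordanDomain.exists_int_abs_sub_lt_of_dist_lt
    (Q : JordanDomain) {τ : ℝ} (hτ : 0 < τ) (hτ1 : τ ≤ 1 / 2) :
    ∃ m > 0, ∀ θ φ : ℝ, dist (Q.boundary θ) (Q.boundary φ) < m → ∃ k : ℤ, |φ - θ - k| < τ := by
  obtain ⟨m, hm, hsep⟩ := Q.exists_pos_le_dist_boundary hτ hτ1
  refine ⟨m, hm, fun θ φ hd => ?_⟩
  -- reduce `φ` modulo `1` to `ψ` with `ψ - θ ∈ [-1/2, 1/2]`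
  set k : ℤ := round (φ - θ) with hk
  refine ⟨k, ?_⟩
  have hround := abs_sub_round (φ - θ)
  set ψ : ℝ := φ - k with hψ
  have hψφ : Q.boundary ψ = Q.boundary φ := by
    rw [hψ, show φ - (k : ℝ) = φ - (k : ℤ) * (1 : ℝ) by ring]
    exact Q.periodic_boundary.sub_int_mul_eq k
  have h1 : |ψ - θ| ≤ 1 / 2 := by
    rw [hψ, show φ - (k : ℝ) - θ = φ - θ - round (φ - θ) by rw [hk]; ring]; exact hround
  by_contra hcon
  have hge : τ ≤ |ψ - θ| := by
    rw [hψ, show φ - (k : ℝ) - θ = φ - θ - k by ring]; exact not_lt.1 hcon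
  rcases le_or_gt 0 (ψ - θ) with h0 | h0
  · rw [abs_of_nonneg h0] at hge h1
    have := hsep θ ψ hge (by linarith)
    rw [hψφ] at this
    linarith
  · rw [abs_of_neg h0] at hge h1
    have := hsep ψ θ (by linarith) (by linarith)
    rw [hψφ, dist_comm] at this
    linarith

/-! ### Gates in loop parameters -/

section Gates

variable (D Q : JordanDomain)

/-- The set of loop parameters mapped into `D` (open). [folklore] -/
def gateParams : Set ℝ := Q.boundary ⁻¹' D.carrier

/-- The parameter set of `D` is open. [folklore] -/
theorem isOpen_gateParams : IsOpen (gateParams D Q) :=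
  D.isOpen.preimage Q.continuous_boundary

variable {D Q}

/-- Membership in the parameter set of `D`. [folklore] -/
theorem mem_gateParams {t : ℝ} : t ∈ gateParams D Q ↔ Q.boundary t ∈ D.carrier := Iff.rfl

/-- The parameter set of `D` is `1`-periodic. [folklore] -/
theorem gateParams_add_int {t : ℝ} (k : ℤ) : t + k ∈ gateParams D Q ↔ t ∈ gateParams D Q := by
  rw [mem_gateParams, mem_gateParams, show t + (k : ℝ) = t + (k : ℤ) * (1 : ℝ) by ring,
    (Q.periodic_boundary.int_mul k) t]

/-- Two distinct points of the loop `∂Q` lie off `D`. [folklore] -/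
def TwoOff (D Q : JordanDomain) : Prop :=
  ∃ θ₁ θ₂ : ℝ, Q.boundary θ₁ ∉ D.carrier ∧ Q.boundary θ₂ ∉ D.carrier ∧ Q.boundary θ₁ ≠ Q.boundary θ₂

/-- Under `TwoOff`, above every parameter there is, within distance `< 1`, a parameter off `D`…
precisely: for every `t` there is `θ ∈ (t, t + 1)` off `D`, unless `Q.boundary t` itself is the
only point off `D` — excluded by `TwoOff`. [folklore] -/
theorem TwoOff.exists_mem_Ioo_not_mem (h : TwoOff D Q) (t : ℝ) :
    ∃ θ ∈ Ioo t (t + 1), θ ∉ gateParams D Q := by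
  obtain ⟨θ₁, θ₂, h₁, h₂, hne⟩ := h
  -- representatives of `θ₁`, `θ₂` in `(t, t + 1]`
  have rep : ∀ θ : ℝ, ∃ θ' ∈ Ioc t (t + 1), Q.boundary θ' = Q.boundary θ := by
    intro θ
    refine ⟨θ - ⌈θ - t⌉ + 1, ?_, ?_⟩
    · have h1 := Int.le_ceil (θ - t)
      have h2 := Int.ceil_lt_add_one (θ - t)
      constructor <;> linarith
    · rw [show θ - (⌈θ - t⌉ : ℝ) + 1 = θ + ((1 - ⌈θ - t⌉ : ℤ) : ℝ) * 1 by push_cast; ring]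
      exact (Q.periodic_boundary.int_mul _) θ
  obtain ⟨φ₁, hφ₁, e₁⟩ := rep θ₁
  obtain ⟨φ₂, hφ₂, e₂⟩ := rep θ₂
  have hφne : φ₁ ≠ φ₂ := fun heq => hne (by rw [← e₁, ← e₂, heq])
  -- at most one of them equals `t + 1`
  by_cases hφ₁t : φ₁ = t + 1
  · refine ⟨φ₂, ⟨hφ₂.1, lt_of_le_of_ne hφ₂.2 fun h' => hφne (hφ₁t.trans h'.symm)⟩, ?_⟩
    rw [mem_gateParams, e₂]; exact h₂
  · refine ⟨φ₁, ⟨hφ₁.1, lt_of_le_of_ne hφ₁.2 hφ₁t⟩, ?_⟩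
    rw [mem_gateParams, e₁]; exact h₁

/-- Under `TwoOff`, below every parameter there is, within distance `< 1`, a parameter off `D`. [folklore] -/
theorem TwoOff.exists_mem_Ioo_not_mem' (h : TwoOff D Q) (t : ℝ) :
    ∃ θ ∈ Ioo (t - 1) t, θ ∉ gateParams D Q := by
  obtain ⟨θ, hθ, hθn⟩ := h.exists_mem_Ioo_not_mem (t - 1)
  exact ⟨θ, ⟨hθ.1, by linarith [hθ.2]⟩, hθn⟩

variable (D Q)

/-- The lower end of the gate through the parameter `t₀`: the largest parameter `≤ t₀` mapped
off `D`. [folklore] -/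
def gateLo (t₀ : ℝ) : ℝ := sSup {θ | θ ≤ t₀ ∧ θ ∉ gateParams D Q}

/-- The upper end of the gate through `t₀`: the least parameter `≥ t₀` mapped off `D`. [folklore] -/
def gateHi (t₀ : ℝ) : ℝ := sInf {θ | t₀ ≤ θ ∧ θ ∉ gateParams D Q}

variable {D Q}

section
variable (h2 : TwoOff D Q) {t₀ : ℝ}
include h2

/-- The set defining `gateLo` is nonempty. [folklore] -/
private theorem loSet_nonempty (t₀ : ℝ) : {θ | θ ≤ t₀ ∧ θ ∉ gateParams D Q}.Nonempty := by
  obtain ⟨θ, hθ, hθn⟩ := h2.exists_mem_Ioo_not_mem' t₀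
  exact ⟨θ, hθ.2.le, hθn⟩

/-- The set defining `gateHi` is nonempty. [folklore] -/
private theorem hiSet_nonempty (t₀ : ℝ) : {θ | t₀ ≤ θ ∧ θ ∉ gateParams D Q}.Nonempty := by
  obtain ⟨θ, hθ, hθn⟩ := h2.exists_mem_Ioo_not_mem t₀
  exact ⟨θ, hθ.1.le, hθn⟩

omit h2 in
/-- The set defining `gateLo` is bounded above. [folklore] -/
private theorem loSet_bddAbove (t₀ : ℝ) : BddAbove {θ | θ ≤ t₀ ∧ θ ∉ gateParams D Q} :=
  ⟨t₀, fun _ h => h.1⟩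

omit h2 in
/-- The set defining `gateHi` is bounded below. [folklore] -/
private theorem hiSet_bddBelow (t₀ : ℝ) : BddBelow {θ | t₀ ≤ θ ∧ θ ∉ gateParams D Q} :=
  ⟨t₀, fun _ h => h.1⟩

omit h2 in
/-- The set defining `gateLo` is closed. [folklore] -/
private theorem isClosed_loSet (t₀ : ℝ) : IsClosed {θ | θ ≤ t₀ ∧ θ ∉ gateParams D Q} :=
  (isClosed_le continuous_id continuous_const).inter (isOpen_gateParams D Q).isClosed_compl

omit h2 in
/-- The set defining `gateHi` is closed. [folklore] -/
private theorem isClosed_hiSet (t₀ : ℝ) : IsClosed {θ | t₀ ≤ θ ∧ θ ∉ gateParams D Q} :=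
  (isClosed_le continuous_const continuous_id).inter (isOpen_gateParams D Q).isClosed_compl

/-- `gateLo t₀` is mapped off `D`. [folklore] -/
theorem gateLo_not_mem (t₀ : ℝ) : gateLo D Q t₀ ∉ gateParams D Q :=
  ((isClosed_loSet t₀).csSup_mem (loSet_nonempty h2 t₀) (loSet_bddAbove t₀)).2

/-- `gateHi t₀` is mapped off `D`. [folklore] -/
theorem gateHi_not_mem (t₀ : ℝ) : gateHi D Q t₀ ∉ gateParams D Q :=
  ((isClosed_hiSet t₀).csInf_mem (hiSet_nonempty h2 t₀) (hiSet_bddBelow t₀)).2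

/-- `gateLo t₀ ≤ t₀`. [folklore] -/
theorem gateLo_le (t₀ : ℝ) : gateLo D Q t₀ ≤ t₀ :=
  ((isClosed_loSet t₀).csSup_mem (loSet_nonempty h2 t₀) (loSet_bddAbove t₀)).1

/-- `t₀ ≤ gateHi t₀`. [folklore] -/
theorem le_gateHi (t₀ : ℝ) : t₀ ≤ gateHi D Q t₀ :=
  ((isClosed_hiSet t₀).csInf_mem (hiSet_nonempty h2 t₀) (hiSet_bddBelow t₀)).1

/-- `gateLo t₀ < t₀` for a parameter `t₀` mapped into `D`. [folklore] -/
theorem gateLo_lt (ht₀ : t₀ ∈ gateParams D Q) : gateLo D Q t₀ < t₀ :=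
  lt_of_le_of_ne (gateLo_le h2 t₀) fun h => gateLo_not_mem h2 t₀ (by rw [h]; exact ht₀)

/-- `t₀ < gateHi t₀` for a parameter `t₀` mapped into `D`. [folklore] -/
theorem lt_gateHi (ht₀ : t₀ ∈ gateParams D Q) : t₀ < gateHi D Q t₀ :=
  lt_of_le_of_ne (le_gateHi h2 t₀) fun h => gateHi_not_mem h2 t₀ (by rw [← h]; exact ht₀)

omit h2 in
/-- The open gate interval is mapped into `D`. [folklore] -/
theorem mem_of_mem_Ioo_gate {θ : ℝ} (hθ : θ ∈ Ioo (gateLo D Q t₀) (gateHi D Q t₀)) :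
    θ ∈ gateParams D Q := by
  by_contra hn
  rcases le_total θ t₀ with h | h
  · have : θ ≤ gateLo D Q t₀ := le_csSup (loSet_bddAbove t₀) ⟨h, hn⟩
    exact absurd hθ.1 this.not_gt
  · have : gateHi D Q t₀ ≤ θ := csInf_le (hiSet_bddBelow t₀) ⟨h, hn⟩
    exact absurd hθ.2 this.not_gt

/-- The gate interval is shorter than a period. [folklore] -/
theorem gateHi_sub_gateLo_lt_one : gateHi D Q t₀ - gateLo D Q t₀ < 1 := by
  by_contra hge
  push Not at hge
  -- a parameter off `D` strictly inside `(gateLo, gateLo + 1)` would lie in the gate interval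
  obtain ⟨θ, hθ, hθn⟩ := h2.exists_mem_Ioo_not_mem (gateLo D Q t₀)
  exact hθn (mem_of_mem_Ioo_gate (t₀ := t₀) ⟨hθ.1, by linarith [hθ.2]⟩)

/-- **Canonicity**: parameters of the same gate interval have the same gate ends. [folklore] -/
theorem gateLo_eq_of_mem {t₁ : ℝ} (ht₁ : t₁ ∈ Ioo (gateLo D Q t₀) (gateHi D Q t₀)) :
    gateLo D Q t₁ = gateLo D Q t₀ := by
  apply le_antisymm
  · -- every `θ ≤ t₁` off `D` is `≤ gateLo t₀`
    refine csSup_le (loSet_nonempty h2 t₁) fun θ hθ => ?_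
    by_contra hlt; push Not at hlt
    exact hθ.2 (mem_of_mem_Ioo_gate (t₀ := t₀) ⟨hlt, lt_of_le_of_lt hθ.1 ht₁.2⟩)
  · exact le_csSup (loSet_bddAbove t₁) ⟨ht₁.1.le, gateLo_not_mem h2 t₀⟩

/-- Canonicity of the upper gate end. [folklore] -/
theorem gateHi_eq_of_mem {t₁ : ℝ} (ht₁ : t₁ ∈ Ioo (gateLo D Q t₀) (gateHi D Q t₀)) :
    gateHi D Q t₁ = gateHi D Q t₀ := by
  apply le_antisymm
  · exact csInf_le (hiSet_bddBelow t₁) ⟨ht₁.2.le, gateHi_not_mem h2 t₀⟩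
  · refine le_csInf (hiSet_nonempty h2 t₁) fun θ hθ => ?_
    by_contra hlt; push Not at hlt
    exact hθ.2 (mem_of_mem_Ioo_gate (t₀ := t₀) ⟨lt_of_lt_of_le ht₁.1 hθ.1, hlt⟩)

/-- Gate ends are `1`-periodic in the parameter. [folklore] -/
theorem gateLo_add_int (k : ℤ) : gateLo D Q (t₀ + k) = gateLo D Q t₀ + k := by
  have key : {θ | θ ≤ t₀ + k ∧ θ ∉ gateParams D Q} = (fun θ : ℝ => θ + k) '' {θ | θ ≤ t₀ ∧ θ ∉ gateParams D Q} := by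
    ext θ
    simp only [mem_setOf_eq, mem_image]
    constructor
    · intro h
      refine ⟨θ - k, ⟨by linarith [h.1], fun hm => h.2 ?_⟩, by ring⟩
      have := (gateParams_add_int (t := θ - k) k).2 hm
      rwa [sub_add_cancel] at this
    · rintro ⟨θ', ⟨h1, h2'⟩, rfl⟩
      exact ⟨by linarith, fun hm => h2' ((gateParams_add_int k).1 hm)⟩
  rw [gateLo, key, gateLo]
  have hmono : Monotone fun θ : ℝ => θ + k := fun a b hab => by linarith
  rw [(hmono.map_csSup_of_continuousAt (continuous_add_const _).continuousAt
    (loSet_nonempty h2 t₀) (loSet_bddAbove t₀))]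

/-- The upper gate end is `1`-periodic in the parameter. [folklore] -/
theorem gateHi_add_int (k : ℤ) : gateHi D Q (t₀ + k) = gateHi D Q t₀ + k := by
  have key : {θ | t₀ + k ≤ θ ∧ θ ∉ gateParams D Q} = (fun θ : ℝ => θ + k) '' {θ | t₀ ≤ θ ∧ θ ∉ gateParams D Q} := by
    ext θ
    simp only [mem_setOf_eq, mem_image]
    constructor
    · intro h
      refine ⟨θ - k, ⟨by linarith [h.1], fun hm => h.2 ?_⟩, by ring⟩
      have := (gateParams_add_int (t := θ - k) k).2 hm
      rwa [sub_add_cancel] at this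
    · rintro ⟨θ', ⟨h1, h2'⟩, rfl⟩
      exact ⟨by linarith, fun hm => h2' ((gateParams_add_int k).1 hm)⟩
  rw [gateHi, key, gateHi]
  have hmono : Monotone fun θ : ℝ => θ + k := fun a b hab => by linarith
  rw [(hmono.map_csInf_of_continuousAt (continuous_add_const _).continuousAt
    (hiSet_nonempty h2 t₀) (hiSet_bddBelow t₀))]

end

end Gates

/-! ### The gate arc is a cross-cut -/

section Arc
variable (D Q)

/-- The (open) **gate** of `D` on `∂Q` through the parameter `t₀`. [folklore] -/
def gate (t₀ : ℝ) : Set ℂ := Q.boundary '' Ioo (gateLo D Q t₀) (gateHi D Q t₀)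

/-- The closed **gate arc**: the gate together with its two end-points. [folklore] -/
def gateArc (t₀ : ℝ) : Set ℂ := Q.boundary '' Icc (gateLo D Q t₀) (gateHi D Q t₀)

variable {D Q}

/-- A gate lies in `D`. [folklore] -/
theorem gate_subset_carrier (t₀ : ℝ) : gate D Q t₀ ⊆ D.carrier := by
  rintro _ ⟨θ, hθ, rfl⟩; exact mem_of_mem_Ioo_gate hθ

/-- The gate lies in the gate arc. [folklore] -/
theorem gate_subset_gateArc (t₀ : ℝ) : gate D Q t₀ ⊆ gateArc D Q t₀ :=
  image_mono Ioo_subset_Icc_self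

/-- The gate arc lies on the loop. [folklore] -/
theorem gateArc_subset_range (t₀ : ℝ) : gateArc D Q t₀ ⊆ range Q.boundary :=
  image_subset_range _ _

/-- A gate lies on the loop `∂Q`. [folklore] -/
theorem gate_subset_frontier (t₀ : ℝ) : gate D Q t₀ ⊆ frontier Q.carrier := by
  rw [← Q.range_boundary]; exact (gate_subset_gateArc t₀).trans (gateArc_subset_range t₀)

variable (h2 : TwoOff D Q) {t₀ : ℝ}
include h2

/-- A point of `D` on the loop lies in its own gate. [folklore] -/
theorem boundary_mem_gate (ht₀ : t₀ ∈ gateParams D Q) : Q.boundary t₀ ∈ gate D Q t₀ :=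
  ⟨t₀, ⟨gateLo_lt h2 ht₀, lt_gateHi h2 ht₀⟩, rfl⟩

/-- The loop is injective on the closed gate interval. [folklore] -/
theorem injOn_boundary_gate (t₀ : ℝ) : InjOn Q.boundary (Icc (gateLo D Q t₀) (gateHi D Q t₀)) := by
  have h1 := gateHi_sub_gateLo_lt_one h2 (t₀ := t₀)
  refine (Q.injOn_boundary_Ico (gateLo D Q t₀)).mono fun θ hθ => ?_
  exact ⟨hθ.1, by linarith [hθ.2]⟩

/-- The two ends of a gate are distinct points. [folklore] -/
theorem boundary_gateLo_ne_gateHi (ht₀ : t₀ ∈ gateParams D Q) :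
    Q.boundary (gateLo D Q t₀) ≠ Q.boundary (gateHi D Q t₀) := by
  intro h
  have hlt : gateLo D Q t₀ < gateHi D Q t₀ := (gateLo_lt h2 ht₀).trans (lt_gateHi h2 ht₀)
  have := injOn_boundary_gate h2 t₀ (left_mem_Icc.2 hlt.le) (right_mem_Icc.2 hlt.le) h
  exact hlt.ne this

/-- **The gate arc is a simple arc** from `Q.boundary gateLo` to `Q.boundary gateHi`. [folklore] -/
theorem isSimpleArc_gateArc (ht₀ : t₀ ∈ gateParams D Q) :
    IsSimpleArc (gateArc D Q t₀) (Q.boundary (gateLo D Q t₀)) (Q.boundary (gateHi D Q t₀)) := by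
  set lo := gateLo D Q t₀
  set hi := gateHi D Q t₀
  have hlt : lo < hi := (gateLo_lt h2 ht₀).trans (lt_gateHi h2 ht₀)
  set a : ℝ → ℝ := fun u => lo + u * (hi - lo) with ha
  have hac : Continuous a := by fun_prop
  have ha_maps : ∀ u ∈ Icc (0 : ℝ) 1, a u ∈ Icc lo hi := fun u hu =>
    ⟨by simp only [ha]; nlinarith [hu.1], by simp only [ha]; nlinarith [hu.2]⟩
  have ha_img : a '' Icc 0 1 = Icc lo hi := by
    apply Subset.antisymm
    · rintro _ ⟨u, hu, rfl⟩; exact ha_maps u hu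
    · intro θ hθ
      refine ⟨(θ - lo) / (hi - lo), ⟨div_nonneg (by linarith [hθ.1]) (by linarith),
        (div_le_one (by linarith)).2 (by linarith [hθ.2])⟩, ?_⟩
      show lo + (θ - lo) / (hi - lo) * (hi - lo) = θ
      rw [div_mul_cancel₀ _ (by linarith : hi - lo ≠ 0)]; ring
  refine ⟨fun u => Q.boundary (a u), (Q.continuous_boundary.comp hac).continuousOn, ?_, ?_, ?_, ?_⟩
  · intro u hu v hv huv
    have h1 := injOn_boundary_gate h2 t₀ (ha_maps u hu) (ha_maps v hv) huv
    simp only [ha] at h1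
    have h2' : (u - v) * (hi - lo) = 0 := by linarith
    rcases mul_eq_zero.1 h2' with h | h
    · linarith
    · exact absurd h (by linarith)
  · rw [show (fun u => Q.boundary (a u)) = Q.boundary ∘ a from rfl, image_comp, ha_img]; rfl
  · show Q.boundary (a 0) = _; simp [ha, lo]
  · show Q.boundary (a 1) = _; simp [ha, hi]

/-- The lower gate end is a boundary point of `D`. [folklore] -/
theorem boundary_gateLo_mem_frontier (ht₀ : t₀ ∈ gateParams D Q) :
    Q.boundary (gateLo D Q t₀) ∈ frontier D.carrier := by
  have hlt : gateLo D Q t₀ < gateHi D Q t₀ := (gateLo_lt h2 ht₀).trans (lt_gateHi h2 ht₀)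
  refine ⟨?_, by rw [D.isOpen.interior_eq]; exact gateLo_not_mem h2 t₀⟩
  have hmem : gateLo D Q t₀ ∈ closure (Ioo (gateLo D Q t₀) (gateHi D Q t₀)) := by
    rw [closure_Ioo hlt.ne]; exact left_mem_Icc.2 hlt.le
  have ht : Tendsto Q.boundary (𝓝[Ioo (gateLo D Q t₀) (gateHi D Q t₀)] gateLo D Q t₀)
      (𝓝 (Q.boundary (gateLo D Q t₀))) := Q.continuous_boundary.continuousWithinAt.tendsto
  haveI := mem_closure_iff_nhdsWithin_neBot.1 hmem
  exact mem_closure_of_tendsto ht (mem_of_superset self_mem_nhdsWithin fun θ hθ => mem_of_mem_Ioo_gate hθ)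

/-- The upper gate end is a boundary point of `D`. [folklore] -/
theorem boundary_gateHi_mem_frontier (ht₀ : t₀ ∈ gateParams D Q) :
    Q.boundary (gateHi D Q t₀) ∈ frontier D.carrier := by
  have hlt : gateLo D Q t₀ < gateHi D Q t₀ := (gateLo_lt h2 ht₀).trans (lt_gateHi h2 ht₀)
  refine ⟨?_, by rw [D.isOpen.interior_eq]; exact gateHi_not_mem h2 t₀⟩
  have hmem : gateHi D Q t₀ ∈ closure (Ioo (gateLo D Q t₀) (gateHi D Q t₀)) := by
    rw [closure_Ioo hlt.ne]; exact right_mem_Icc.2 hlt.le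
  have ht : Tendsto Q.boundary (𝓝[Ioo (gateLo D Q t₀) (gateHi D Q t₀)] gateHi D Q t₀)
      (𝓝 (Q.boundary (gateHi D Q t₀))) := Q.continuous_boundary.continuousWithinAt.tendsto
  haveI := mem_closure_iff_nhdsWithin_neBot.1 hmem
  exact mem_closure_of_tendsto ht (mem_of_superset self_mem_nhdsWithin fun θ hθ => mem_of_mem_Ioo_gate hθ)

/-- The gate is the gate arc minus its two end-points. [folklore] -/
theorem gate_eq_gateArc_diff (t₀ : ℝ) :
    gate D Q t₀ = gateArc D Q t₀ \ {Q.boundary (gateLo D Q t₀), Q.boundary (gateHi D Q t₀)} := by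
  apply Subset.antisymm
  · rintro _ ⟨θ, hθ, rfl⟩
    refine ⟨⟨θ, Ioo_subset_Icc_self hθ, rfl⟩, ?_⟩
    rintro (h | h)
    · exact hθ.1.ne' (injOn_boundary_gate h2 t₀ (Ioo_subset_Icc_self hθ)
        (left_mem_Icc.2 (hθ.1.le.trans hθ.2.le)) h)
    · exact hθ.2.ne (injOn_boundary_gate h2 t₀ (Ioo_subset_Icc_self hθ)
        (right_mem_Icc.2 (hθ.1.le.trans hθ.2.le)) h)
  · rintro z ⟨⟨θ, hθ, rfl⟩, hz⟩
    simp only [mem_insert_iff, mem_singleton_iff, not_or] at hz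
    refine ⟨θ, ⟨lt_of_le_of_ne hθ.1 fun h => hz.1 (by rw [h]), lt_of_le_of_ne hθ.2 fun h => hz.2 (by rw [h])⟩, rfl⟩

/-- `D` minus the gate arc is `D` minus the gate (the ends are off `D`). [folklore] -/
theorem carrier_diff_gateArc (t₀ : ℝ) : D.carrier \ gateArc D Q t₀ = D.carrier \ gate D Q t₀ := by
  apply Subset.antisymm
  · exact fun z hz => ⟨hz.1, fun h => hz.2 (gate_subset_gateArc t₀ h)⟩
  · rintro z ⟨hz, hzg⟩
    refine ⟨hz, fun hza => hzg ?_⟩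
    rw [gate_eq_gateArc_diff h2]
    refine ⟨hza, ?_⟩
    rintro (h' | h')
    · exact gateLo_not_mem h2 t₀ (show Q.boundary (gateLo D Q t₀) ∈ D.carrier by rw [← h']; exact hz)
    · exact gateHi_not_mem h2 t₀ (show Q.boundary (gateHi D Q t₀) ∈ D.carrier by rw [← h']; exact hz)

/-- **The gate arc is a cross-cut of `D`.** [folklore] -/
theorem isCrosscut_gateArc (ht₀ : t₀ ∈ gateParams D Q) :
    D.IsCrosscut (gateArc D Q t₀) (Q.boundary (gateLo D Q t₀)) (Q.boundary (gateHi D Q t₀)) := by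
  refine ⟨isSimpleArc_gateArc h2 ht₀, boundary_gateLo_mem_frontier h2 ht₀,
    boundary_gateHi_mem_frontier h2 ht₀, boundary_gateLo_ne_gateHi h2 ht₀, ?_⟩
  rw [← gate_eq_gateArc_diff h2]
  exact gate_subset_carrier t₀

end Arc

/-! ### Newman's theorem for a gate -/

/-- Two distinct boundary points of a Jordan domain are `boundary σ`, `boundary τ` with
`σ < τ < σ + 1`. [folklore] -/
theorem _root_.Literature.Probability.RandomPlanarGeometry.JordanDomain.exists_params_of_ne (D : JordanDomain)
    {p q : ℂ} (hp : p ∈ frontier D.carrier) (hq : q ∈ frontier D.carrier) (hne : p ≠ q) :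
    ∃ σ τ : ℝ, σ < τ ∧ τ < σ + 1 ∧ D.boundary σ = p ∧ D.boundary τ = q := by
  rw [← D.range_boundary] at hp hq
  obtain ⟨σ, rfl⟩ := hp
  obtain ⟨τ₀, rfl⟩ := hq
  -- representative of `τ₀` in `(σ, σ + 1]`, which cannot be `σ + 1`
  set τ : ℝ := τ₀ - ⌈τ₀ - σ⌉ + 1 with hτ
  have h1 := Int.le_ceil (τ₀ - σ)
  have h2 := Int.ceil_lt_add_one (τ₀ - σ)
  have hτeq : D.boundary τ = D.boundary τ₀ := by
    rw [hτ, show τ₀ - (⌈τ₀ - σ⌉ : ℝ) + 1 = τ₀ + ((1 - ⌈τ₀ - σ⌉ : ℤ) : ℝ) * 1 by push_cast; ring]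
    exact (D.periodic_boundary.int_mul _) τ₀
  refine ⟨σ, τ, by linarith, lt_of_le_of_ne (by linarith) fun h => hne ?_, rfl, hτeq⟩
  rw [← hτeq, h]
  exact (D.periodic_boundary σ).symm

/-- **Newman's cross-cut theorem for a gate**: `D` minus a gate splits into exactly two domains,
each having the whole gate arc in its frontier; their frontiers are the gate arc together with
the two arcs of `∂D` cut off by the gate ends `D.boundary σ = Q.boundary gateLo`,
`D.boundary τ = Q.boundary gateHi` (`σ < τ < σ + 1`). [cite: Newman1939, Ch. V §11, Thms. 11·7–11·8] -/
theorem exists_gate_sides {D Q : JordanDomain} (h2 : TwoOff D Q) {t₀ : ℝ} (ht₀ : t₀ ∈ gateParams D Q) :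
    ∃ σ τ : ℝ, ∃ U₁ U₂ : Set ℂ, σ < τ ∧ τ < σ + 1 ∧
      D.boundary σ = Q.boundary (gateLo D Q t₀) ∧ D.boundary τ = Q.boundary (gateHi D Q t₀) ∧
      IsOpen U₁ ∧ IsOpen U₂ ∧ IsConnected U₁ ∧ IsConnected U₂ ∧ Disjoint U₁ U₂ ∧
      U₁ ∪ U₂ = D.carrier \ gate D Q t₀ ∧
      frontier U₁ = gateArc D Q t₀ ∪ D.boundary '' Icc σ τ ∧
      frontier U₂ = gateArc D Q t₀ ∪ D.boundary '' Icc τ (σ + 1) := by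
  obtain ⟨σ, τ, hστ, hτσ, hσ, hτ⟩ := D.exists_params_of_ne (boundary_gateLo_mem_frontier h2 ht₀)
    (boundary_gateHi_mem_frontier h2 ht₀) (boundary_gateLo_ne_gateHi h2 ht₀)
  have hcc := isCrosscut_gateArc h2 ht₀
  rw [← hσ, ← hτ] at hcc
  obtain ⟨U₁, U₂, ho₁, ho₂, hc₁, hc₂, hdisj, hunion, hf₁, hf₂⟩ :=
    Newman1939_crosscut_holds D (gateArc D Q t₀) σ τ hστ hτσ hcc
  refine ⟨σ, τ, U₁, U₂, hστ, hτσ, hσ, hτ, ho₁, ho₂, hc₁, hc₂, hdisj, ?_, hf₁, hf₂⟩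
  rw [hunion, carrier_diff_gateArc h2]

/-! ### The two sides of a gate seen from a base point -/

section Sides

variable (D Q : JordanDomain)

/-- The **side** of the gate through `t₀` containing the base point `g`: the connected component
of `g` in `D` minus the gate. [folklore] -/
def gateSide (g : ℂ) (t₀ : ℝ) : Set ℂ := connectedComponentIn (D.carrier \ gate D Q t₀) g

/-- The **far side** of the gate through `t₀` (seen from `g`): the rest of `D` minus the gate.
[folklore] -/
def gateFar (g : ℂ) (t₀ : ℝ) : Set ℂ := (D.carrier \ gate D Q t₀) \ gateSide D Q g t₀

variable {D Q}

/-- The side of `g` lies in `D` minus the gate. [folklore] -/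
theorem gateSide_subset (g : ℂ) (t₀ : ℝ) : gateSide D Q g t₀ ⊆ D.carrier \ gate D Q t₀ :=
  connectedComponentIn_subset _ _

/-- The far side lies in `D` minus the gate. [folklore] -/
theorem gateFar_subset (g : ℂ) (t₀ : ℝ) : gateFar D Q g t₀ ⊆ D.carrier \ gate D Q t₀ :=
  sdiff_subset

/-- The two sides of a gate are disjoint. [folklore] -/
theorem disjoint_gateSide_gateFar (g : ℂ) (t₀ : ℝ) : Disjoint (gateSide D Q g t₀) (gateFar D Q g t₀) :=
  disjoint_sdiff_right

/-- The two sides cover `D` minus the gate. [folklore] -/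
theorem gateSide_union_gateFar {g : ℂ} {t₀ : ℝ} :
    gateSide D Q g t₀ ∪ gateFar D Q g t₀ = D.carrier \ gate D Q t₀ :=
  union_sdiff_cancel (gateSide_subset g t₀)

/-- The base point lies in its side. [folklore] -/
theorem mem_gateSide {g : ℂ} {t₀ : ℝ} (hg : g ∈ D.carrier \ gate D Q t₀) : g ∈ gateSide D Q g t₀ :=
  mem_connectedComponentIn hg

/-- The side of `g` is preconnected. [folklore] -/
theorem isPreconnected_gateSide (g : ℂ) (t₀ : ℝ) : IsPreconnected (gateSide D Q g t₀) :=
  isPreconnected_connectedComponentIn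

/-- A preconnected subset of `D` minus the gate that meets the side of `g` lies in it. [folklore] -/
theorem subset_gateSide_of_isPreconnected {g : ℂ} {t₀ : ℝ} {S : Set ℂ} (hS : IsPreconnected S)
    (hSD : S ⊆ D.carrier \ gate D Q t₀) (hmeet : (S ∩ gateSide D Q g t₀).Nonempty) :
    S ⊆ gateSide D Q g t₀ := by
  obtain ⟨z, hzS, hz⟩ := hmeet
  rw [gateSide] at hz ⊢
  rw [connectedComponentIn_eq hz]
  exact hS.subset_connectedComponentIn hzS hSD

/-- In a disjoint union of two open connected sets, the component of a point of the first is the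
first. [folklore] -/
private theorem connectedComponentIn_union_eq_left {U₁ U₂ : Set ℂ} (ho₁ : IsOpen U₁) (ho₂ : IsOpen U₂)
    (hc₁ : IsConnected U₁) (hdisj : Disjoint U₁ U₂) {g : ℂ} (hg : g ∈ U₁) :
    connectedComponentIn (U₁ ∪ U₂) g = U₁ := by
  apply Subset.antisymm
  · have hpre : IsPreconnected (connectedComponentIn (U₁ ∪ U₂) g) := isPreconnected_connectedComponentIn
    have hsub : connectedComponentIn (U₁ ∪ U₂) g ⊆ U₁ ∪ U₂ := connectedComponentIn_subset _ _
    exact hpre.subset_left_of_subset_union ho₁ ho₂ hdisj hsub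
      ⟨g, mem_connectedComponentIn (Or.inl hg), hg⟩
  · exact hc₁.isPreconnected.subset_connectedComponentIn hg subset_union_left

/-- **The two sides of a gate** (Newman): the side of `g` and the far side are disjoint, open,
connected, nonempty, cover `D` minus the gate, and both have the whole gate arc in their
frontier; the frontiers are the gate arc together with the two complementary arcs of `∂D` cut
off by the gate ends. [cite: Newman1939, Ch. V §11, Thms. 11·7–11·8] -/
theorem gateSide_gateFar_spec (h2 : TwoOff D Q) {t₀ : ℝ} (ht₀ : t₀ ∈ gateParams D Q) {g : ℂ}
    (hg : g ∈ D.carrier \ gate D Q t₀) :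
    IsOpen (gateSide D Q g t₀) ∧ IsOpen (gateFar D Q g t₀) ∧
    IsConnected (gateSide D Q g t₀) ∧ IsConnected (gateFar D Q g t₀) ∧
    ∃ σ τ : ℝ, σ < τ ∧ τ < σ + 1 ∧
      ({D.boundary σ, D.boundary τ} : Set ℂ) = {Q.boundary (gateLo D Q t₀), Q.boundary (gateHi D Q t₀)} ∧
      frontier (gateSide D Q g t₀) = gateArc D Q t₀ ∪ D.boundary '' Icc σ τ ∧
      frontier (gateFar D Q g t₀) = gateArc D Q t₀ ∪ D.boundary '' Icc τ (σ + 1) := by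
  obtain ⟨σ, τ, U₁, U₂, hστ, hτσ, hσ, hτ, ho₁, ho₂, hc₁, hc₂, hdisj, hunion, hf₁, hf₂⟩ :=
    exists_gate_sides h2 ht₀
  have hg' : g ∈ U₁ ∪ U₂ := by rw [hunion]; exact hg
  -- periodicity of the second arc
  have hper : D.boundary '' Icc (σ + 1) (τ + 1) = D.boundary '' Icc σ τ := by
    have : Icc (σ + 1) (τ + 1) = (fun θ => θ + 1) '' Icc σ τ := by
      rw [image_add_const_Icc]
    rw [this, ← image_comp]
    refine image_congr fun θ _ => ?_
    exact D.periodic_boundary θ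
  rcases hg' with hg₁ | hg₂
  · -- `g ∈ U₁`: side = U₁, far = U₂
    have hside : gateSide D Q g t₀ = U₁ := by
      rw [gateSide, ← hunion]; exact connectedComponentIn_union_eq_left ho₁ ho₂ hc₁ hdisj hg₁
    have hfar : gateFar D Q g t₀ = U₂ := by
      rw [gateFar, hside, ← hunion, union_sdiff_cancel_left (Set.disjoint_iff.1 hdisj)]
    rw [hside, hfar]
    exact ⟨ho₁, ho₂, hc₁, hc₂, σ, τ, hστ, hτσ, by rw [hσ, hτ], hf₁, hf₂⟩
  · -- `g ∈ U₂`: side = U₂, far = U₁; relabel `σ' = τ`, `τ' = σ + 1`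
    have hside : gateSide D Q g t₀ = U₂ := by
      rw [gateSide, ← hunion, union_comm]
      exact connectedComponentIn_union_eq_left ho₂ ho₁ hc₂ hdisj.symm hg₂
    have hfar : gateFar D Q g t₀ = U₁ := by
      rw [gateFar, hside, ← hunion, union_sdiff_cancel_right (Set.disjoint_iff.1 hdisj)]
    rw [hside, hfar]
    refine ⟨ho₂, ho₁, hc₂, hc₁, τ, σ + 1, hτσ, by linarith, ?_, hf₂, ?_⟩
    · rw [D.periodic_boundary σ, hσ, hτ, pair_comm]
    · rw [hper]; exact hf₁

section Conv
variable (h2 : TwoOff D Q) {t₀ : ℝ} (ht₀ : t₀ ∈ gateParams D Q) {g : ℂ} (hg : g ∈ D.carrier \ gate D Q t₀)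
include h2 ht₀ hg

/-- The side of `g` is open. [folklore] -/
theorem isOpen_gateSide : IsOpen (gateSide D Q g t₀) := (gateSide_gateFar_spec h2 ht₀ hg).1

/-- The far side is open. [folklore] -/
theorem isOpen_gateFar : IsOpen (gateFar D Q g t₀) := (gateSide_gateFar_spec h2 ht₀ hg).2.1

/-- The side of `g` is connected. [folklore] -/
theorem isConnected_gateSide : IsConnected (gateSide D Q g t₀) := (gateSide_gateFar_spec h2 ht₀ hg).2.2.1

/-- The far side is connected. [folklore] -/
theorem isConnected_gateFar : IsConnected (gateFar D Q g t₀) := (gateSide_gateFar_spec h2 ht₀ hg).2.2.2.1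

/-- The gate arc lies in the frontier of the side of `g`. [cite: Newman1939, Ch. V §11, Thm. 11·7] -/
theorem gateArc_subset_frontier_gateSide : gateArc D Q t₀ ⊆ frontier (gateSide D Q g t₀) := by
  obtain ⟨-, -, -, -, σ, τ, -, -, -, hf, -⟩ := gateSide_gateFar_spec h2 ht₀ hg
  rw [hf]; exact subset_union_left

/-- The gate arc lies in the frontier of the far side. [cite: Newman1939, Ch. V §11, Thm. 11·7] -/
theorem gateArc_subset_frontier_gateFar : gateArc D Q t₀ ⊆ frontier (gateFar D Q g t₀) := by
  obtain ⟨-, -, -, -, σ, τ, -, -, -, -, hf⟩ := gateSide_gateFar_spec h2 ht₀ hg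
  rw [hf]; exact subset_union_left

/-- Every point of the gate is a limit of points of the far side. [folklore] -/
theorem gate_subset_closure_gateFar : gate D Q t₀ ⊆ closure (gateFar D Q g t₀) :=
  ((gate_subset_gateArc t₀).trans (gateArc_subset_frontier_gateFar h2 ht₀ hg)).trans
    frontier_subset_closure

/-- Every point of the gate is a limit of points of the side of `g`. [folklore] -/
theorem gate_subset_closure_gateSide : gate D Q t₀ ⊆ closure (gateSide D Q g t₀) :=
  ((gate_subset_gateArc t₀).trans (gateArc_subset_frontier_gateSide h2 ht₀ hg)).trans
    frontier_subset_closure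

end Conv

end Sides

end Literature.Topology.PlaneTopology
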